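/-
Copyright (c) 2026 the pub-hodgecm-mathlib formalisation cell (harness21).  Prover seat hodgecm-mathlib-K2E5-p17 (g7), Track B «K2-LIT»,
#184♮ = hLiu418 = `stmt-HodgeConjecture-24832`; organ S2, sub-organ S2-⊗ (LEAD F0P6-plan (g14) BATCH #13∕#14 (2), K2Liu-p11 (g2) census 2026-09-04T12:31:39Z (⊗-1),
co-dealer K2E5-plan (g7) 12:32:27Z): FILE 2a — the GENERIC separation of variables of a function with finite-dimensional one-coordinate slices.  2026-09-04.
-/
import Summits.HodgeConjecture.HodgeConjecture.Theorems.K2LiuKFiniteSectionMultiPlaceDecomposition   -- ★ S3-F4 (K2Liu-p13): `exists_interpolation` (generic, `W ≤ (X → ℂ)`)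
import HarnessLib

/-!
# Crux `HLiu418`, organ S2, sub-organ S2-⊗, FILE 2a: SEPARATION OF VARIABLES — a function on a finite product `Π i, X i` whose one-coordinate slices lie in fixed
# finite-dimensional spaces `W i` is a finite sum of pure products `Σ_r c_r ∏_i b_{r,i}(g_i)` with `b_{r,i} ∈ W i`

Cell `hodgecm-mathlib`, crux item hLiu418 = `stmt-HodgeConjecture-24832`, route of record `HCCMUnconditional`; squad K2 ∕ K2Liu, prover K2E5-p17 (g7).
THEOREMS ONLY (no `def`, no instance, no notation, no named-fact hypothesis, no `sorry`); lane `--supports stmt-HodgeConjecture-24832 --as helper` (count-neutral).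

THE MATHEMATICS ([BorelJacquet1979, §4.1 (admissible `(𝔤,K)×G(𝔸_f)`-modules, factorizable vectors)]; [Flath1979, §2]; p11's census (⊗-1) «matrix coefficients + re-expansion
in a basis of the slice space»).  Pure finite-dimensional linear algebra, no topology, no Haar measure, no group law (the product-GROUP form is a one-line corollary):
for `F : (Π i, X i) → ℂ` (`ι` finite) such that for every coordinate `i` and every base point `x` the slice `u ↦ F(x with x_i := u)` lies in a FIXED finite-dimensional
subspace `W i ≤ (X i → ℂ)`, there are `m`, scalars `c r` and functions `b r i ∈ W i` with **`F g = Σ_r c_r · ∏_i b_{r,i}(g_i)`** for all `g`.  Proof: Finset induction on the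
set `T` of separated coordinates with EXPLICIT away-factors (★ S3-F4's device): `F g = Σ_r (Σ_j κ_{rj} F(T.piecewise t_j g)) · ∏_{i∈T} b_{ri}(g_i)` — the away-factors are
finite combinations of VALUES of `F` at points whose `T`-coordinates are frozen, so their `w`-slices (`w ∉ T`) are slices of `F` and lie in `W w`; the step `T → insert w T` is
★ `exists_interpolation (W w)` (the coordinate functionals of a finite-dimensional space of functions are finite combinations of evaluations) + `Finset.piecewise_insert`;
at `T = univ` the away-factors are the constants `Σ_j κ_{rj} F(t_j)`.  CONSEQUENCE (the two binders of LEAD BATCH #14 (2), as S2-⊗ FILE 2b uses them): stability of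
the ambient finite-dimensional space under right translation by the FULL product compact `∏_w K_w` is what makes every one-place slice land in a fixed `W w` (hypothesis
`hF`); and any LINEAR, SLICE-STABLE property (the one-place Siegel law — slices of a product-Siegel section through `w`-trivial points are one-place Siegel sections because
left `P_w`-translation commutes with freezing the other coordinates —, one-place `K_w`-finiteness, continuity) is propagated to the factors simply by choosing `W w` to
encode it: the conclusion `b r i ∈ W i` IS the propagation.
* §1 `update_one_mul_mulSingle` (`(x with x_i := 1) · ι_i(u) = (x with x_i := u)` in a product group);
* §2 **`exists_sum_prod_on_finset`** (the induction, explicit away-factors), **`exists_sum_prod_of_update_slices`** (`T = univ`),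
  **`exists_sum_prod_of_mulSingle_slices`** (product-group form with slices `u ↦ F(x · ι_i(u))` through `i`-trivial `x`, as p11's FILE 2b consumes it).
HONEST LABEL: HC_CM is proved only modulo the 7 printed citations (2 remaining named inputs: hLiu418 = stmt-HodgeConjecture-24832, h413 = stmt-HodgeConjecture-24833) until
rung 0 closes; this file is a count-neutral generic helper and closes no item.

## Mathlib ∕ tree search
Tree ★: `K2LiuKFiniteSectionMultiPlaceDecomposition.exists_interpolation` (and its `exists_sum_pure_on_finset` as the pattern).  Mathlib: `Finset.induction_on`, `Finset.piecewise_insert`,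
`Finset.piecewise_congr`, `Finset.piecewise_univ`, `Finset.prod_insert`, `Function.update_*`, `finProdFinEquiv`, `Equiv.sum_comp`, `Fintype.sum_prod_type`, `Finset.sum_comm`, `Pi.mulSingle`.
Dedup: `rg "TensorSeparation|exists_sum_prod_of_update_slices|mulSingle_slices"` over `Theorems/` — none.

## References
* [BorelJacquet1979] A. Borel, H. Jacquet, *Automorphic forms and automorphic representations*, PSPM 33.1 (1979), §4.1.
* [Flath1979] D. Flath, *Decomposition of representations into tensor products*, PSPM 33.1 (1979), §2.
-/

set_option autoImplicit false
-- the mandated namespace repeats `HodgeConjecture.HodgeConjecture`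
set_option linter.dupNamespace false

noncomputable section

namespace Summit.HodgeConjecture.HodgeConjecture.Cruxes.HLiu418.K2LiuFiniteTranslatesTensorSeparation

open Summit.HodgeConjecture.HodgeConjecture.Cruxes.HLiu418.K2LiuKFiniteSectionMultiPlaceDecomposition (exists_interpolation)

/-! ## §1 Slices in a product group -/

/-- in a product group, `(x with x_i := 1) · ι_i(u) = (x with x_i := u)` (`ι_i = Pi.mulSingle i`). [folklore] -/
theorem update_one_mul_mulSingle {ι : Type*} [DecidableEq ι] {G : ι → Type*} [∀ i, Group (G i)] (x : Π i, G i) (i : ι) (u : G i) :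
    Function.update x i 1 * Pi.mulSingle i u = Function.update x i u := by
  funext j
  by_cases hj : j = i
  · subst hj
    rw [Pi.mul_apply, Function.update_self, Function.update_self, Pi.mulSingle_eq_same, one_mul]
  · rw [Pi.mul_apply, Function.update_of_ne hj, Function.update_of_ne hj, Pi.mulSingle_eq_of_ne hj, mul_one]

/-- `x · ι_i(u) = (x with x_i := x_i u)`; in particular for `i`-trivial `x` (`x_i = 1`) it is `(x with x_i := u)`. [folklore] -/
theorem mul_mulSingle_eq_update {ι : Type*} [DecidableEq ι] {G : ι → Type*} [∀ i, Group (G i)] (x : Π i, G i) (i : ι) (hx : x i = 1) (u : G i) :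
    x * Pi.mulSingle i u = Function.update x i u := by
  conv_lhs => rw [← Function.update_eq_self i x, hx]
  exact update_one_mul_mulSingle x i u

/-! ## §2 Separation of variables -/

/-- **THE INDUCTION WITH EXPLICIT AWAY-FACTORS** (pattern of ★ S3-F4 `exists_sum_pure_on_finset`): if every one-coordinate slice of `F : (Π i, X i) → ℂ` lies in the
finite-dimensional `W i`, then for every finite set `T` of coordinates there are `b r i ∈ W i`, scalars `κ r j` and points `t j` with
`F g = Σ_r (Σ_j κ_{rj} · F(T.piecewise t_j g)) · ∏_{i ∈ T} b_{ri}(g_i)` — the away-factors are combinations of values of `F` at points with frozen `T`-coordinates.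
[cite: BorelJacquet1979, §4.1] [cite: Flath1979, §2] -/
theorem exists_sum_prod_on_finset {ι : Type*} [DecidableEq ι] {X : ι → Type*} [∀ i, Nonempty (X i)]
    (W : ∀ i, Submodule ℂ (X i → ℂ)) [∀ i, FiniteDimensional ℂ ↥(W i)] (F : (Π i, X i) → ℂ)
    (hF : ∀ (i : ι) (x : Π i, X i), (fun u : X i => F (Function.update x i u)) ∈ W i) (T : Finset ι) :
    ∃ (m : ℕ) (b : Fin m → Π i, (X i → ℂ)) (k : ℕ) (κ : Fin m → Fin k → ℂ) (t : Fin k → Π i, X i),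
      (∀ r i, b r i ∈ W i) ∧ ∀ g, F g = ∑ r, (∑ j, κ r j * F (T.piecewise (t j) g)) * ∏ i ∈ T, b r i (g i) := by
  classical
  induction T using Finset.induction_on with
  | empty =>
    refine ⟨1, fun _ _ => 0, 1, fun _ _ => 1, fun _ i => Classical.arbitrary (X i), fun r i => Submodule.zero_mem _, fun g => ?_⟩
    simp only [Finset.univ_unique, Fin.default_eq_zero, Fin.isValue, Finset.sum_singleton, one_mul, Finset.piecewise_empty, Finset.prod_empty, mul_one]
  | insert w T hw ih =>
    obtain ⟨m, b, k, κ, t, hb, hFg⟩ := ih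
    obtain ⟨m', bw, k', s, c, hbw, hint⟩ := exists_interpolation (W w)
    -- the one-place step at `w` applied to the away-factors: for every point `y`,
    -- `F y = Σ_{i'} (Σ_{j'} c i' j' · F (y with y_w := s j')) · bw i' (y w)`
    have hstep : ∀ y : Π i, X i, F y = ∑ i', (∑ j', c i' j' * F (Function.update y w (s j'))) * bw i' (y w) := by
      intro y
      have h := hint _ (hF w y) (y w)
      simp only [Function.update_eq_self] at h
      exact h
    -- frozen points: `(T.piecewise (t j) g with g_w := s j') = (insert w T).piecewise (t j with := s j') g`
    have hfreeze : ∀ (j : Fin k) (j' : Fin k') (g : Π i, X i),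
        Function.update (T.piecewise (t j) g) w (s j') = (insert w T).piecewise (Function.update (t j) w (s j')) g := by
      intro j j' g
      rw [Finset.piecewise_insert, Function.update_self,
        T.piecewise_congr (fun i hi => Function.update_of_ne (ne_of_mem_of_not_mem hi hw) (s j') (t j)) (fun _ _ => rfl)]
    refine ⟨m * m', fun R => Function.update (b (finProdFinEquiv.symm R).1) w (bw (finProdFinEquiv.symm R).2), k * k',
      fun R J => κ (finProdFinEquiv.symm R).1 (finProdFinEquiv.symm J).1 * c (finProdFinEquiv.symm R).2 (finProdFinEquiv.symm J).2,
      fun J => Function.update (t (finProdFinEquiv.symm J).1) w (s (finProdFinEquiv.symm J).2), fun R i => ?_, fun g => ?_⟩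
    · dsimp only
      by_cases hi : i = w
      · subst hi
        rw [Function.update_self]
        exact hbw _
      · rw [Function.update_of_ne hi]
        exact hb _ _
    · -- both sides as double sums over `Fin m × Fin m'` (resp. `Fin k × Fin k'`)
      have hP : ∀ (r : Fin m) (i' : Fin m'), ∏ i ∈ insert w T, Function.update (b r) w (bw i') i (g i) = bw i' (g w) * ∏ i ∈ T, b r i (g i) := by
        intro r i'
        rw [Finset.prod_insert hw, Function.update_self]
        refine congrArg _ (Finset.prod_congr rfl fun i hi => ?_)
        rw [Function.update_of_ne (ne_of_mem_of_not_mem hi hw)]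
      rw [hFg g, ← finProdFinEquiv.sum_comp, Fintype.sum_prod_type]
      refine Finset.sum_congr rfl fun r _ => ?_
      simp only [Equiv.symm_apply_apply, hP]
      -- inner: rewrite the away-values by the one-place step and regroup
      have hin : ∀ j : Fin k, F (T.piecewise (t j) g) = ∑ i', (∑ j', c i' j' * F ((insert w T).piecewise (Function.update (t j) w (s j')) g)) * bw i' (g w) := by
        intro j
        rw [hstep (T.piecewise (t j) g), T.piecewise_eq_of_notMem _ _ hw]
        simp only [hfreeze]
      simp only [hin, ← finProdFinEquiv.sum_comp (fun J : Fin (k * k') => κ r (finProdFinEquiv.symm J).1 * c _ (finProdFinEquiv.symm J).2 * F _),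
        Equiv.symm_apply_apply, Fintype.sum_prod_type, Finset.mul_sum, Finset.sum_mul]
      rw [Finset.sum_comm]
      refine Finset.sum_congr rfl fun i' _ => Finset.sum_congr rfl fun j _ => ?_
      refine Finset.sum_congr rfl fun j' _ => ?_
      ring

/-- **SEPARATION OF VARIABLES (⊗-1).**  `ι` finite, `X i` arbitrary (nonempty) types, `W i ≤ (X i → ℂ)` finite-dimensional; if every one-coordinate slice `u ↦ F(x with x_i := u)`
of `F : (Π i, X i) → ℂ` lies in `W i`, then **`F g = Σ_r c_r · ∏_i b_{r,i}(g_i)`** for some `m`, scalars `c : Fin m → ℂ` and `b r i ∈ W i`.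
[cite: BorelJacquet1979, §4.1] [cite: Flath1979, §2] -/
theorem exists_sum_prod_of_update_slices {ι : Type*} [Fintype ι] [DecidableEq ι] {X : ι → Type*} [∀ i, Nonempty (X i)]
    (W : ∀ i, Submodule ℂ (X i → ℂ)) [∀ i, FiniteDimensional ℂ ↥(W i)] (F : (Π i, X i) → ℂ)
    (hF : ∀ (i : ι) (x : Π i, X i), (fun u : X i => F (Function.update x i u)) ∈ W i) :
    ∃ (m : ℕ) (c : Fin m → ℂ) (b : Fin m → Π i, (X i → ℂ)), (∀ r i, b r i ∈ W i) ∧ ∀ g, F g = ∑ r, c r * ∏ i, b r i (g i) := by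
  classical
  obtain ⟨m, b, k, κ, t, hb, hFg⟩ := exists_sum_prod_on_finset W F hF Finset.univ
  refine ⟨m, fun r => ∑ j, κ r j * F (t j), b, hb, fun g => ?_⟩
  rw [hFg g]
  simp only [Finset.piecewise_univ]

/-- **SEPARATION OF VARIABLES, PRODUCT-GROUP FORM** (the shape S2-⊗ FILE 2b consumes): `G i` groups, `W i ≤ (G i → ℂ)` finite-dimensional; if for every `i` and every
`i`-TRIVIAL `x` (`x_i = 1`) the slice `u ↦ F(x · ι_i(u))` (`ι_i = Pi.mulSingle i`) lies in `W i`, then `F g = Σ_r c_r · ∏_i b_{r,i}(g_i)` with `b r i ∈ W i`.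
[cite: BorelJacquet1979, §4.1] [cite: Flath1979, §2] -/
theorem exists_sum_prod_of_mulSingle_slices {ι : Type*} [Fintype ι] [DecidableEq ι] {G : ι → Type*} [∀ i, Group (G i)]
    (W : ∀ i, Submodule ℂ (G i → ℂ)) [∀ i, FiniteDimensional ℂ ↥(W i)] (F : (Π i, G i) → ℂ)
    (hF : ∀ (i : ι) (x : Π i, G i), x i = 1 → (fun u : G i => F (x * Pi.mulSingle i u)) ∈ W i) :
    ∃ (m : ℕ) (c : Fin m → ℂ) (b : Fin m → Π i, (G i → ℂ)), (∀ r i, b r i ∈ W i) ∧ ∀ g, F g = ∑ r, c r * ∏ i, b r i (g i) := by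
  haveI : ∀ i, Nonempty (G i) := fun i => ⟨1⟩
  refine exists_sum_prod_of_update_slices W F fun i x => ?_
  have h := hF i (Function.update x i 1) (Function.update_self i (1 : G i) x)
  have hfun : (fun u : G i => F (Function.update x i 1 * Pi.mulSingle i u)) = fun u => F (Function.update x i u) :=
    funext fun u => by rw [update_one_mul_mulSingle]
  rw [hfun] at h
  exact h

end Summit.HodgeConjecture.HodgeConjecture.Cruxes.HLiu418.K2LiuFiniteTranslatesTensorSeparation

end
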